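import Literature.Analysis.FluidPDE.ClassicalNSFourierModes
import Literature.Analysis.FluidPDE.TorusClassicalNSTimeDerivLinearised
import HarnessLib

/-!
# The Duhamel (variation-of-constants) formula for a classical Navier–Stokes solution tested
# against a Stokes eigenmode

Analysis/FluidPDE support file (theorem-only).  For a classical solution `(u, p)` of the forced
incompressible Navier–Stokes system on `[a, b] × T^d` (`Torus.IsClassicalNSSolutionOn`) and a smooth
divergence-free eigenfield `φ` of the Laplacian, `Δφ = -λφ` (every Stokes eigenmode on the flat torus
is of this form), the tested momentum equation
`d/dt ∫⟪u, φ⟫ = ∫⟪u, (u·∇)φ⟫ + ν∫⟪u, Δφ⟫ + ∫⟪f, φ⟫`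
(`IsClassicalNSSolutionOn.hasDerivWithinAt_integral_inner`, file `ClassicalNSFourierModes.lean`)
is the scalar linear ODE `c' = -νλ c + g` for the mode coefficient `c(t) = ∫⟪u(t), φ⟫` with the
continuous source `g(t) = ∫⟪u(t), (u(t)·∇)φ⟫ + ∫⟪f(t), φ⟫`, whence the **Duhamel formula**
`c(t) = e^{-νλ(t-a)} c(a) + ∫ₐᵗ e^{-νλ(t-s)} g(s) ds`
(`IsClassicalNSSolutionOn.integral_inner_eq_exp_mul_add_integral`).  Summed over the Stokes
eigenbasis this is the mild (integral) form `u(t) = e^{-νtA}u(a) + ∫ₐᵗ e^{-ν(t-s)A} P(f - (u·∇)u) ds`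
of the equation in the energy space (Constantin–Foias 1988, Ch. 5 (5.9)–(5.10); Robinson–Rodrigo–
Sadowski 2016, (3.9)) — the identification of classical with mild solutions used by the smooth-model
construction of the Navier–Stokes semiflow.

* `eq_exp_mul_add_integral_of_hasDerivWithinAt` — the scalar variation-of-constants formula for
  `c' = -μ c + g` within `[a, b]` (product rule for `e^{μ(s-a)} c(s)` and the fundamental theorem of
  calculus);
* `IsClassicalNSSolutionOn.continuousOn_modeSource` — continuity of the source `g`;
* `IsClassicalNSSolutionOn.hasDerivWithinAt_integral_inner_of_eigenmode` — `c' = -νλ c + g`;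
* `IsClassicalNSSolutionOn.integral_inner_eq_exp_mul_add_integral` — the Duhamel formula.

## Mathlib search

Used: `intervalIntegral.integral_eq_sub_of_hasDeriv_right_of_le`, `HasDerivWithinAt.mono_of_mem_nhdsWithin`,
`Icc_mem_nhds` / `mem_nhdsWithin_of_mem_nhds`, `HasDerivAt.exp`, `HasDerivWithinAt.congr_deriv`,
`intervalIntegral.integral_const_mul`.  No Navier–Stokes notions in Mathlib; the tested momentum
equation and the space–time calculus (`IsSmoothSpaceTimeOn.continuousOn_integral`, `.inner`, `.convect`,
`IsClassicalNSSolutionOn.smooth_force`) are the tree's.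

## References

* P. Constantin, C. Foias, *Navier–Stokes Equations* (Chicago 1988), Ch. 5, (5.9)–(5.10).
  [ConstantinFoiasNSE1988]
* J. C. Robinson, J. L. Rodrigo, W. Sadowski, *The Three-Dimensional Navier–Stokes Equations*
  (CUP 2016), (3.9) and Lemma 3.6. [RobinsonRodrigoSadowski2016]
-/

noncomputable section

open MeasureTheory Set Filter Function
open scoped InnerProductSpace RealInnerProductSpace Topology

namespace Literature.Analysis.FluidPDE

open Literature.Analysis.FunctionSpaces Literature.Analysis.FunctionSpaces.Torus

variable {d : Type*} [Fintype d] [DecidableEq d]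

/-! ## The scalar variation-of-constants formula -/

section Scalar

omit [Fintype d] [DecidableEq d] in
/-- **Variation of constants for `c' = -μ c + g` on `[a, b]`.**  If `c` has the one-sided derivative
`-μ c(s) + g(s)` within `[a, b]` at every `s ∈ [a, b]` and `g` is continuous on `[a, b]`, then
`c(t) = e^{-μ(t-a)} c(a) + ∫ₐᵗ e^{-μ(t-s)} g(s) ds` for `t ∈ [a, b]` (differentiate `e^{μ(s-a)} c(s)`
and integrate). [folklore] -/
theorem eq_exp_mul_add_integral_of_hasDerivWithinAt {a b μ : ℝ} {c g : ℝ → ℝ}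
    (hc : ∀ s ∈ Icc a b, HasDerivWithinAt c (-(μ * c s) + g s) (Icc a b) s)
    (hg : ContinuousOn g (Icc a b)) {t : ℝ} (ht : t ∈ Icc a b) :
    c t = Real.exp (-(μ * (t - a))) * c a + ∫ s in a..t, Real.exp (-(μ * (t - s))) * g s := by
  -- the integrating factor `e^{μ(s-a)}`
  have hexp : ∀ s, HasDerivAt (fun r => Real.exp (μ * (r - a))) (μ * Real.exp (μ * (s - a))) s := by
    intro s
    have h1 : HasDerivAt (fun r => μ * (r - a)) μ s := by
      simpa using ((hasDerivAt_id s).sub_const a).const_mul μ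
    simpa [mul_comm] using h1.exp
  have hw : ∀ s ∈ Icc a b, HasDerivWithinAt (fun r => Real.exp (μ * (r - a)) * c r)
      (Real.exp (μ * (s - a)) * g s) (Icc a b) s := by
    intro s hs
    have h := ((hexp s).hasDerivWithinAt (s := Icc a b)).mul (hc s hs)
    refine h.congr_deriv ?_
    ring
  have hwcont : ContinuousOn (fun r => Real.exp (μ * (r - a)) * c r) (Icc a b) :=
    fun s hs => (hw s hs).continuousWithinAt
  have hat : a ≤ t := ht.1
  -- fundamental theorem of calculus on `[a, t]`
  have hderiv : ∀ s ∈ Ioo a t, HasDerivWithinAt (fun r => Real.exp (μ * (r - a)) * c r)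
      (Real.exp (μ * (s - a)) * g s) (Ioi s) s := by
    intro s hs
    have hs' : s ∈ Icc a b := ⟨hs.1.le, hs.2.le.trans ht.2⟩
    exact (hw s hs').mono_of_mem_nhdsWithin
      (mem_nhdsWithin_of_mem_nhds (Icc_mem_nhds hs.1 (hs.2.trans_le ht.2)))
  have hint : IntervalIntegrable (fun s => Real.exp (μ * (s - a)) * g s) volume a t := by
    refine ContinuousOn.intervalIntegrable ?_
    rw [uIcc_of_le hat]
    exact (Real.continuous_exp.comp (continuous_const.mul (continuous_id.sub continuous_const))).continuousOn.mul
      (hg.mono (Icc_subset_Icc_right ht.2))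
  have hftc := intervalIntegral.integral_eq_sub_of_hasDeriv_right_of_le hat
    (hwcont.mono (Icc_subset_Icc_right ht.2)) hderiv hint
  -- `∫ₐᵗ e^{μ(s-a)} g = e^{μ(t-a)} c(t) - c(a)`
  have ha0 : Real.exp (μ * (a - a)) * c a = c a := by simp
  rw [ha0] at hftc
  -- multiply through by `e^{-μ(t-a)}`
  have hE : Real.exp (-(μ * (t - a))) * Real.exp (μ * (t - a)) = 1 := by
    rw [← Real.exp_add]; simp
  have hkey : c t = Real.exp (-(μ * (t - a))) * c a +
      Real.exp (-(μ * (t - a))) * ∫ s in a..t, Real.exp (μ * (s - a)) * g s := by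
    calc c t = Real.exp (-(μ * (t - a))) * (Real.exp (μ * (t - a)) * c t) := by
          rw [← mul_assoc, hE, one_mul]
      _ = Real.exp (-(μ * (t - a))) * ((∫ s in a..t, Real.exp (μ * (s - a)) * g s) + c a) := by
          rw [hftc, sub_add_cancel]
      _ = _ := by ring
  rw [hkey, ← intervalIntegral.integral_const_mul]
  congr 1
  refine intervalIntegral.integral_congr fun s _ => ?_
  show Real.exp (-(μ * (t - a))) * (Real.exp (μ * (s - a)) * g s) = Real.exp (-(μ * (t - s))) * g s
  rw [← mul_assoc, ← Real.exp_add, show -(μ * (t - a)) + μ * (s - a) = -(μ * (t - s)) by ring]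

end Scalar

/-! ## The mode coefficients of a classical solution -/

section Modes

variable {a b ν : ℝ} {f u : ℝ → UnitAddTorus d → EuclideanSpace ℝ d} {p : ℝ → UnitAddTorus d → ℝ}

/-- **The source of the mode ODE is continuous in time**: for a classical solution on `[a, b] × T^d`
(`a < b`) and a smooth field `φ`, `s ↦ ∫⟪u(s), (u(s)·∇)φ⟫ + ∫⟪f(s), φ⟫` is continuous on `[a, b]`
(space integrals of jointly smooth fields; the force is jointly smooth by
`IsClassicalNSSolutionOn.smooth_force`). [folklore] -/
theorem _root_.Literature.Analysis.FunctionSpaces.Torus.IsClassicalNSSolutionOn.continuousOn_modeSource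
    (h : IsClassicalNSSolutionOn (Icc a b) ν f u p) (hab : a < b)
    {φ : UnitAddTorus d → EuclideanSpace ℝ d} (hφ : IsSmooth φ) :
    ContinuousOn (fun s => (∫ x, ⟪u s x, convect (u s) φ x⟫) + ∫ x, ⟪f s x, φ x⟫) (Icc a b) := by
  have hU : UniqueDiffOn ℝ (Icc a b) := uniqueDiffOn_Icc hab
  have hu : IsSmoothSpaceTimeOn (Icc a b) u := h.smooth_velocity
  have hφ' : IsSmoothSpaceTimeOn (Icc a b) (fun _ : ℝ => φ) := isSmoothSpaceTimeOn_const hφ _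
  have h1 : IsSmoothSpaceTimeOn (Icc a b) (fun s x => ⟪u s x, convect (u s) φ x⟫) :=
    hu.inner (hu.convect hφ' hU)
  have h2 : IsSmoothSpaceTimeOn (Icc a b) (fun s x => ⟪f s x, φ x⟫) := (h.smooth_force hU).inner hφ'
  exact (h1.continuousOn_integral (convex_Icc a b)).add (h2.continuousOn_integral (convex_Icc a b))

/-- **The mode ODE**: for a classical solution on `[a, b] × T^d` (`a < b`) and a smooth divergence-free
eigenfield `Δφ = -λφ`, the coefficient `c(s) = ∫⟪u(s), φ⟫` satisfies
`c' = -νλ c + (∫⟪u, (u·∇)φ⟫ + ∫⟪f, φ⟫)` within `[a, b]` (the tested momentum equation with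
`ν∫⟪u, Δφ⟫ = -νλ ∫⟪u, φ⟫`). [cite: RobinsonRodrigoSadowski2016, (3.9) and Lemma 3.6] -/
theorem _root_.Literature.Analysis.FunctionSpaces.Torus.IsClassicalNSSolutionOn.hasDerivWithinAt_integral_inner_of_eigenmode
    (h : IsClassicalNSSolutionOn (Icc a b) ν f u p) (hab : a < b)
    {φ : UnitAddTorus d → EuclideanSpace ℝ d} (hφ : IsSmooth φ) (hdiv : IsDivFree φ)
    {lam : ℝ} (heig : ∀ x, laplacian φ x = -(lam • φ x)) {s : ℝ} (hs : s ∈ Icc a b) :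
    HasDerivWithinAt (fun r => ∫ x, ⟪u r x, φ x⟫)
      (-(ν * lam * ∫ x, ⟪u s x, φ x⟫) + ((∫ x, ⟪u s x, convect (u s) φ x⟫) + ∫ x, ⟪f s x, φ x⟫))
      (Icc a b) s := by
  have hU : UniqueDiffOn ℝ (Icc a b) := uniqueDiffOn_Icc hab
  have hD := h.hasDerivWithinAt_integral_inner (convex_Icc a b) hU hφ hdiv hs
  have hL : ∫ x, ⟪u s x, laplacian φ x⟫ = -(lam * ∫ x, ⟪u s x, φ x⟫) := by
    have hpt : (fun x => ⟪u s x, laplacian φ x⟫) = fun x => -lam * ⟪u s x, φ x⟫ := by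
      funext x
      rw [heig x, inner_neg_right, real_inner_smul_right]
      ring
    rw [hpt, integral_const_mul]
    ring
  convert hD using 1
  rw [hL]
  ring

/-- **Duhamel formula for the mode coefficients of a classical Navier–Stokes solution.**  For a
classical solution `(u, p)` of `∂ₜu + (u·∇)u = νΔu − ∇p + f`, `div u = 0` on `[a, b] × T^d` and a smooth
divergence-free eigenfield `φ` of the Laplacian, `Δφ = -λφ` (e.g. a Stokes eigenmode on the flat torus),
for every `t ∈ [a, b]`:
`∫⟪u(t), φ⟫ = e^{-νλ(t-a)} ∫⟪u(a), φ⟫ + ∫ₐᵗ e^{-νλ(t-s)} (∫⟪u(s), (u(s)·∇)φ⟫ + ∫⟪f(s), φ⟫) ds`.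
This is the coefficientwise form of the mild formulation
`u(t) = e^{-ν(t-a)A} u(a) + ∫ₐᵗ e^{-ν(t-s)A} P(f − (u·∇)u) ds` in the energy space (Constantin–Foias 1988,
Ch. 5 (5.9)–(5.10); Robinson–Rodrigo–Sadowski 2016, (3.9): `⟪(u·∇)u, φ⟫ = -⟪u, (u·∇)φ⟫`).
[cite: ConstantinFoiasNSE1988, Ch. 5 (5.9)–(5.10)] -/
theorem _root_.Literature.Analysis.FunctionSpaces.Torus.IsClassicalNSSolutionOn.integral_inner_eq_exp_mul_add_integral
    (h : IsClassicalNSSolutionOn (Icc a b) ν f u p)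
    {φ : UnitAddTorus d → EuclideanSpace ℝ d} (hφ : IsSmooth φ) (hdiv : IsDivFree φ)
    {lam : ℝ} (heig : ∀ x, laplacian φ x = -(lam • φ x)) {t : ℝ} (ht : t ∈ Icc a b) :
    ∫ x, ⟪u t x, φ x⟫ =
      Real.exp (-(ν * lam * (t - a))) * (∫ x, ⟪u a x, φ x⟫) +
        ∫ s in a..t, Real.exp (-(ν * lam * (t - s))) *
          ((∫ x, ⟪u s x, convect (u s) φ x⟫) + ∫ x, ⟪f s x, φ x⟫) := by
  rcases eq_or_lt_of_le (ht.1.trans ht.2) with hab | hab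
  · -- degenerate window `a = b`: then `t = a`
    subst hab
    have hta : t = a := le_antisymm ht.2 ht.1
    subst hta
    simp
  · exact eq_exp_mul_add_integral_of_hasDerivWithinAt (μ := ν * lam)
      (fun s hs => h.hasDerivWithinAt_integral_inner_of_eigenmode hab hφ hdiv heig hs)
      (h.continuousOn_modeSource hab hφ) ht

end Modes

end Literature.Analysis.FluidPDE

end
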